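import Mathlib.LinearAlgebra.Matrix.PosDef
import Mathlib.Analysis.SpecialFunctions.Sqrt
import Literature.Geometry.Lorentzian.MinimalSurfaceTangency
import Literature.Geometry.Lorentzian.CoordCurvature
import HarnessLib

/-!
# The minimal-graph operator of a chart: the symbol (Fontenele–Silva 2001, §3)
(family `gr`, in support of **gr.S09**; namespace `Literature.Geometry.Lorentzian.MinimalGraph`)

Support file (everything proved; real definitions, no named facts) for the discharge of
`Literature.Geometry.Lorentzian.minimalGraph_strongMaximumPrinciple`, reduced by
`TangencyMaximumPrinciple.lean` to the construction of a `MinimalGraphOperator h ψ T` for every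
chart `ψ` of the maximal atlas of a Riemannian `3`-manifold and every linear straightening
`T : E3 ≃ ℝ² × ℝ`. Following Fontenele–Silva, Illinois J. Math. 45 (2001), §3 (Lemma 3.1,
(3.3)–(3.5), Prop. 3.2 with `r = 1`) with the chart inverse in place of `exp_p`, the operator is an
explicit function `Φ(r, q, z, x)` of a second-order jet built from the components
`G : E3 → (E3 →L E3 →L ℝ)` of the metric in the chart. This file defines its ingredients purely in
coordinates (no manifold appears) and proves the pointwise algebra behind ellipticity:

* `levelCovector T q = ℓ_q` — the differential `dx³ − Σ qᵢ dxⁱ` of the level function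
  `height − u(horizontal)` of a graph with gradient `q`; `graphDiff T q = A_q` — the differential
  `a ↦ T⁻¹(a, q·a)` of the graph map; `ℓ_q ∘ A_q = 0`, `ℓ_q(T⁻¹(0, s)) = s`;
* `rawNormal`, `normSq`, `unitNormal` — `n = ♯ℓ_q`, `W² = ℓ_q(n) = G(n, n) > 0`, `N = n/W`, the
  `G`-unit normal of the graph: `G(N, A_q a) = 0`, `G(N, N) = 1`, `G(N, T⁻¹(0, s)) = s/W`;
* `apply_fderiv_unitNormal_graphDiff` — **the ellipticity identity**: differentiating
  `G(N(q), A_q c) ≡ 0` in the gradient variable, `G(∂_q N(w), A_q c) = −(Σ wᵢ cᵢ)/W`.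

## References

* F. Fontenele, S. L. Silva, *A tangency principle and applications*, Illinois J. Math. 45 (2001)
  213–228, §3, Lemma 3.1, (3.3)–(3.5), Prop. 3.2, Prop. 3.4.
* L. Andersson, G. J. Galloway, R. Howard, Comm. Pure Appl. Math. 51 (1998) 581–624, §3.1
  (`H = Σ aⁱʲ(x, f, Df) Dᵢⱼf + b(x, f, Df)`, the normal `(∂ₙ + Σ gⁱʲ Dᵢf ∂ⱼ)/W`).
-/

noncomputable section

-- instance search on the nested operator spaces `E3 →L[ℝ] E3 →L[ℝ] E3 →L[ℝ] ℝ`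
set_option maxSynthPendingDepth 3

open Set Function Filter Module
open scoped Topology ContDiff Matrix

namespace Literature.Geometry.Lorentzian

namespace MinimalGraph

/-- The base of a second-order jet: gradient slot, value slot and base point `(q, z, x)`, so that
`Jet 2 = (Fin 2 → Fin 2 → ℝ) × JetBase`. [cite: FonteneleSilva2001, §2 (2.2)] -/
abbrev JetBase : Type := (Fin 2 → ℝ) × ℝ × EuclideanSpace ℝ (Fin 2)

variable (T : E3 ≃L[ℝ] EuclideanSpace ℝ (Fin 2) × ℝ)

/-! ### Linear algebra of the straightened chart -/

/-- Pairing with a gradient vector: `a ↦ Σ qᵢ aᵢ` on `ℝ²`. [folklore] -/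
def dotL (q : Fin 2 → ℝ) : EuclideanSpace ℝ (Fin 2) →L[ℝ] ℝ :=
  ∑ i, q i • EuclideanSpace.proj i

/-- `dotL q a = Σ qᵢ aᵢ`. [folklore] -/
@[simp]
theorem dotL_apply (q : Fin 2 → ℝ) (a : EuclideanSpace ℝ (Fin 2)) : dotL q a = ∑ i, q i * a i := by
  simp [dotL]

/-- Pairing with a fixed vector of `ℝ²` as a functional of the gradient slot: `w ↦ Σ cᵢ wᵢ`.
[folklore] -/
def dotR (c : EuclideanSpace ℝ (Fin 2)) : (Fin 2 → ℝ) →L[ℝ] ℝ :=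
  ∑ i, c i • ContinuousLinearMap.proj i

/-- `dotR c w = Σ cᵢ wᵢ`. [folklore] -/
@[simp]
theorem dotR_apply (c : EuclideanSpace ℝ (Fin 2)) (w : Fin 2 → ℝ) : dotR c w = ∑ i, c i * w i := by
  simp [dotR]

/-- The point of `E3` under a jet base: `y(q, z, x) = T⁻¹(x, z)`. [folklore] -/
def basePt (b : JetBase) : E3 :=
  T.symm (b.2.2, b.2.1)

/-- Unfolding lemma for `basePt`. [folklore] -/
theorem basePt_apply (b : JetBase) : basePt T b = T.symm (b.2.2, b.2.1) := rfl

/-- **The level covector** `ℓ_q = dx³ − Σ qᵢ dxⁱ` (read through `T`): the differential of the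
level function `x ↦ x³ − u(x¹, x²)` of a graph `x³ = u` at a point where `∇u = q`; its kernel is
the tangent plane of the graph. [cite: AnderssonGallowayHoward1998, §3.1] -/
def levelCovector (q : Fin 2 → ℝ) : E3 →L[ℝ] ℝ :=
  (ContinuousLinearMap.snd ℝ (EuclideanSpace ℝ (Fin 2)) ℝ -
      (dotL q).comp (ContinuousLinearMap.fst ℝ (EuclideanSpace ℝ (Fin 2)) ℝ)).comp
    (T : E3 →L[ℝ] EuclideanSpace ℝ (Fin 2) × ℝ)

/-- `ℓ_q(v) = (T v)³ − Σ qᵢ (T v)ⁱ`. [folklore] -/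
@[simp]
theorem levelCovector_apply (q : Fin 2 → ℝ) (v : E3) :
    levelCovector T q v = (T v).2 - ∑ i, q i * (T v).1 i := by
  simp [levelCovector]

/-- **The differential of the graph map** `Gr_u(x) = T⁻¹(x, u x)` at a point where `∇u = q`:
`A_q(a) = T⁻¹(a, Σ qᵢ aᵢ)`. [cite: FonteneleSilva2001, §3 (the vectors ψ_k)] -/
def graphDiff (q : Fin 2 → ℝ) : EuclideanSpace ℝ (Fin 2) →L[ℝ] E3 :=
  (T.symm : EuclideanSpace ℝ (Fin 2) × ℝ →L[ℝ] E3).comp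
    ((ContinuousLinearMap.id ℝ (EuclideanSpace ℝ (Fin 2))).prod (dotL q))

/-- `A_q(a) = T⁻¹(a, Σ qᵢ aᵢ)`. [folklore] -/
@[simp]
theorem graphDiff_apply (q : Fin 2 → ℝ) (a : EuclideanSpace ℝ (Fin 2)) :
    graphDiff T q a = T.symm (a, ∑ i, q i * a i) := by
  simp [graphDiff]

/-- The tangent vectors of the graph lie in the kernel of the level covector: `ℓ_q(A_q a) = 0`.
[folklore] -/
@[simp]
theorem levelCovector_graphDiff (q : Fin 2 → ℝ) (a : EuclideanSpace ℝ (Fin 2)) :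
    levelCovector T q (graphDiff T q a) = 0 := by
  simp

/-- The level covector is normalised on the vertical direction: `ℓ_q(T⁻¹(0, s)) = s`. [folklore] -/
@[simp]
theorem levelCovector_vertical (q : Fin 2 → ℝ) (s : ℝ) :
    levelCovector T q (T.symm (0, s)) = s := by
  simp

/-- The graph differential is injective (its first component is the identity). [folklore] -/
theorem graphDiff_injective (q : Fin 2 → ℝ) : Function.Injective (graphDiff T q) := by
  intro a a' h
  have h' := congrArg (fun v ↦ (T v).1) h
  simpa using h'

/-! ### The unit normal of a graph in the metric `G` -/

variable (G : E3 → E3 →L[ℝ] E3 →L[ℝ] ℝ)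

/-- The raw normal `n = ♯ℓ_q` of the graph at the jet base `b = (q, z, x)`: the `G_y`-dual vector
of the level covector, `y = T⁻¹(x, z)` (Andersson–Galloway–Howard 1998, §3.1: the vector
`∂ₙ + Σ gⁱʲ Dᵢf ∂ⱼ` before normalisation). [cite: AnderssonGallowayHoward1998, §3.1] -/
def rawNormal (b : JetBase) : E3 :=
  MetricCoord.sharpAt G (basePt T b) (levelCovector T b.1)

/-- The squared length `W² = ℓ_q(n) = G_y(n, n)` of the raw normal. [cite: AnderssonGallowayHoward1998, §3.1] -/
def normSq (b : JetBase) : ℝ :=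
  levelCovector T b.1 (rawNormal T G b)

/-- **The unit normal of the graph**, `N = n / W`, as a function of the jet base `(q, z, x)`
(Fontenele–Silva 2001, §3: "η(x) depends on x, µ(x) and the first order derivatives of µ(x)").
[cite: FonteneleSilva2001, §3 (3.3) ff.] -/
def unitNormal (b : JetBase) : E3 :=
  (Real.sqrt (normSq T G b))⁻¹ • rawNormal T G b

variable {T G}

/-- `G_y(n, w) = ℓ_q(w)`: the raw normal is the metric dual of the level covector.
[cite: ONeill1983, Ch. 3, p. 60] -/
theorem apply_rawNormal {b : JetBase} (hinv : (G (basePt T b)).IsInvertible) (w : E3) :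
    G (basePt T b) (rawNormal T G b) w = levelCovector T b.1 w :=
  MetricCoord.apply_sharpAt_apply hinv _ w

/-- The raw normal is not zero (`ℓ_q ≠ 0`). [folklore] -/
theorem rawNormal_ne_zero {b : JetBase} (hinv : (G (basePt T b)).IsInvertible) :
    rawNormal T G b ≠ 0 := fun h ↦ by
  have h1 := apply_rawNormal hinv (T.symm (0, 1))
  rw [h, map_zero, zero_apply, levelCovector_vertical] at h1
  exact zero_ne_one h1

/-- `W² = G_y(n, n)`. [folklore] -/
theorem normSq_eq {b : JetBase} (hinv : (G (basePt T b)).IsInvertible) :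
    normSq T G b = G (basePt T b) (rawNormal T G b) (rawNormal T G b) :=
  (apply_rawNormal hinv _).symm

/-- `W² > 0` for a positive definite `G_y`. [folklore] -/
theorem normSq_pos {b : JetBase} (hinv : (G (basePt T b)).IsInvertible)
    (hpos : ∀ v : E3, v ≠ 0 → 0 < G (basePt T b) v v) : 0 < normSq T G b := by
  rw [normSq_eq hinv]
  exact hpos _ (rawNormal_ne_zero hinv)

/-- `G_y(N, w) = ℓ_q(w) / W`. [folklore] -/
theorem apply_unitNormal {b : JetBase} (hinv : (G (basePt T b)).IsInvertible) (w : E3) :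
    G (basePt T b) (unitNormal T G b) w = (Real.sqrt (normSq T G b))⁻¹ * levelCovector T b.1 w := by
  rw [unitNormal, map_smul, smul_apply, apply_rawNormal hinv, smul_eq_mul]

/-- **The unit normal is normal to the graph**: `G_y(N, A_q a) = 0`.
[cite: FonteneleSilva2001, §3 (η normal to the hyperplane spanned by ψ_m)] -/
theorem apply_unitNormal_graphDiff {b : JetBase} (hinv : (G (basePt T b)).IsInvertible)
    (a : EuclideanSpace ℝ (Fin 2)) :
    G (basePt T b) (unitNormal T G b) (graphDiff T b.1 a) = 0 := by
  rw [apply_unitNormal hinv, levelCovector_graphDiff, mul_zero]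

/-- `G_y(N, T⁻¹(0, s)) = s / W` on the vertical direction. [folklore] -/
theorem apply_unitNormal_vertical {b : JetBase} (hinv : (G (basePt T b)).IsInvertible) (s : ℝ) :
    G (basePt T b) (unitNormal T G b) (T.symm (0, s)) = (Real.sqrt (normSq T G b))⁻¹ * s := by
  rw [apply_unitNormal hinv, levelCovector_vertical]

/-- **The unit normal is a unit vector**: `G_y(N, N) = 1` for positive definite `G_y`.
[cite: FonteneleSilva2001, §3 (η unitary)] -/
theorem apply_unitNormal_self {b : JetBase} (hinv : (G (basePt T b)).IsInvertible)
    (hpos : ∀ v : E3, v ≠ 0 → 0 < G (basePt T b) v v) :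
    G (basePt T b) (unitNormal T G b) (unitNormal T G b) = 1 := by
  have hW := normSq_pos hinv hpos
  rw [apply_unitNormal hinv, unitNormal, map_smul, smul_eq_mul]
  rw [show levelCovector T b.1 (rawNormal T G b) = normSq T G b from rfl]
  rw [← mul_assoc, ← mul_inv, Real.mul_self_sqrt hW.le, inv_mul_cancel₀ hW.ne']

/-! ### The ellipticity identity -/

/-- The graph differential applied to a fixed vector is affine in the gradient slot, with
derivative `w ↦ T⁻¹(0, Σ cᵢ wᵢ)`. [folklore] -/
theorem hasFDerivAt_graphDiff_apply (c : EuclideanSpace ℝ (Fin 2)) (q : Fin 2 → ℝ) :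
    HasFDerivAt (fun q' : Fin 2 → ℝ ↦ graphDiff T q' c)
      ((T.symm : EuclideanSpace ℝ (Fin 2) × ℝ →L[ℝ] E3).comp
        ((ContinuousLinearMap.inr ℝ (EuclideanSpace ℝ (Fin 2)) ℝ).comp (dotR c))) q := by
  have h1 : HasFDerivAt (fun q' : Fin 2 → ℝ ↦ ((c, (0 : ℝ)) : EuclideanSpace ℝ (Fin 2) × ℝ) +
      (ContinuousLinearMap.inr ℝ (EuclideanSpace ℝ (Fin 2)) ℝ) (dotR c q'))
      ((ContinuousLinearMap.inr ℝ (EuclideanSpace ℝ (Fin 2)) ℝ).comp (dotR c)) q :=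
    (((ContinuousLinearMap.inr ℝ (EuclideanSpace ℝ (Fin 2)) ℝ).comp (dotR c)).hasFDerivAt).const_add _
  have h2 := (T.symm : EuclideanSpace ℝ (Fin 2) × ℝ →L[ℝ] E3).hasFDerivAt.comp q h1
  refine h2.congr_of_eventuallyEq (Eventually.of_forall fun q' ↦ ?_)
  simp only [Function.comp_apply, graphDiff_apply, ContinuousLinearMap.inr_apply, dotR_apply,
    Prod.mk_add_mk, add_zero, zero_add, ContinuousLinearEquiv.coe_coe]
  congr 2
  exact Finset.sum_congr rfl fun i _ ↦ mul_comm _ _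

/-- **The ellipticity identity.** At a jet base `b = (q, z, x)` with `G_y` invertible
(`y = T⁻¹(x, z)`), if the unit normal, as a function of the gradient slot alone, has derivative
`N'` at `q`, then for every `w` and every `c ∈ ℝ²`
`G_y(N' w, A_q c) = −(Σ wᵢ cᵢ) / W`:
differentiate the identity `G_y(N(q'), A_{q'} c) = 0` (`apply_unitNormal_graphDiff`, `y` fixed) at
`q' = q` and use `∂_{q'}(A_{q'} c)(w) = T⁻¹(0, Σ cᵢ wᵢ)`, `G_y(N, T⁻¹(0, s)) = s / W`. This is the
computation behind Fontenele–Silva's Prop. 3.4 for `r = 1` (`Σ ∂Φ₁/∂r_kl ξ_k ξ_l = (ω/n) ξᵀFξ`):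
the Hessian slot enters the second fundamental form only through `∂_q N`, paired with the
tangent vectors `A_q e_j`. [cite: FonteneleSilva2001, Prop. 3.4 (r = 1)] -/
theorem apply_fderiv_unitNormal_graphDiff {b : JetBase} (hinv : (G (basePt T b)).IsInvertible)
    {N' : (Fin 2 → ℝ) →L[ℝ] E3}
    (hN : HasFDerivAt (fun q' : Fin 2 → ℝ ↦ unitNormal T G (q', b.2)) N' b.1)
    (w : Fin 2 → ℝ) (c : EuclideanSpace ℝ (Fin 2)) :
    G (basePt T b) (N' w) (graphDiff T b.1 c) =
      -((Real.sqrt (normSq T G b))⁻¹ * ∑ i, w i * c i) := by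
  -- the identity `G_y(N(q'), A_{q'} c) = 0` for all `q'` (the base point does not move)
  have hF : (fun q' : Fin 2 → ℝ ↦ G (basePt T b) (unitNormal T G (q', b.2)) (graphDiff T q' c)) =
      fun _ ↦ (0 : ℝ) := by
    funext q'
    exact apply_unitNormal_graphDiff (b := (q', b.2)) hinv c
  -- differentiate it at `q' = b.1`
  have hf : HasFDerivAt (fun q' : Fin 2 → ℝ ↦ G (basePt T b) (unitNormal T G (q', b.2)))
      ((G (basePt T b)).comp N') b.1 :=
    (G (basePt T b)).hasFDerivAt.comp b.1 hN
  have hF' := hf.clm_apply (hasFDerivAt_graphDiff_apply (T := T) c b.1)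
  have h0 : HasFDerivAt
      (fun q' : Fin 2 → ℝ ↦ G (basePt T b) (unitNormal T G (q', b.2)) (graphDiff T q' c))
      (0 : (Fin 2 → ℝ) →L[ℝ] ℝ) b.1 := by
    rw [hF]
    exact hasFDerivAt_const 0 b.1
  have hD := DFunLike.congr_fun (hF'.unique h0) w
  simp only [add_apply, ContinuousLinearMap.comp_apply,
    ContinuousLinearMap.flip_apply, zero_apply,
    ContinuousLinearMap.inr_apply, ContinuousLinearEquiv.coe_coe, dotR_apply] at hD
  -- `hD : G(N q)(T⁻¹(0, Σ cᵢ wᵢ)) + G(N' w)(A_q c) = 0`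
  have hv : G (basePt T b) (unitNormal T G (b.1, b.2)) (T.symm (0, ∑ i, c i * w i)) =
      (Real.sqrt (normSq T G b))⁻¹ * ∑ i, c i * w i :=
    apply_unitNormal_vertical (b := (b.1, b.2)) hinv _
  rw [hv] at hD
  have hcomm : ∑ i, w i * c i = ∑ i, c i * w i := Finset.sum_congr rfl fun i _ ↦ mul_comm _ _
  rw [hcomm]
  linarith

/-! ### Regularity of the unit normal -/

section Regularity

variable (T G)

/-- The base point is a smooth (affine) function of the jet base. [folklore] -/
theorem contDiff_basePt : ContDiff ℝ ∞ (basePt T) :=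
  T.symm.contDiff.comp ((contDiff_snd.comp contDiff_snd).prodMk (contDiff_fst.comp contDiff_snd))

/-- The pairing `q ↦ dotL q` is smooth (linear) in the gradient slot. [folklore] -/
theorem contDiff_dotL : ContDiff ℝ ∞ (fun q : Fin 2 → ℝ ↦ dotL q) := by
  unfold dotL
  exact ContDiff.sum fun i _ ↦ (contDiff_apply ℝ ℝ i).smul contDiff_const

/-- The level covector is a smooth (affine) function of the gradient slot. [folklore] -/
theorem contDiff_levelCovector : ContDiff ℝ ∞ (fun q : Fin 2 → ℝ ↦ levelCovector T q) := by
  unfold levelCovector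
  exact (contDiff_const.sub ((contDiff_dotL).clm_comp contDiff_const)).clm_comp contDiff_const

/-- The graph differential applied to a fixed vector is a smooth (affine) function of the
gradient slot. [folklore] -/
theorem contDiff_graphDiff_apply (c : EuclideanSpace ℝ (Fin 2)) :
    ContDiff ℝ ∞ (fun q : Fin 2 → ℝ ↦ graphDiff T q c) := by
  have h : (fun q : Fin 2 → ℝ ↦ graphDiff T q c) =
      fun q ↦ T.symm (c, dotL q c) := by
    funext q
    rw [graphDiff_apply, dotL_apply]
  rw [h]
  exact T.symm.contDiff.comp (contDiff_const.prodMk ((contDiff_dotL).clm_apply contDiff_const))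

variable {T G} {V : Set E3}

/-- The set of jet bases whose base point lies in the open set `V` is open. [folklore] -/
theorem isOpen_basePt_preimage (hV : IsOpen V) : IsOpen {b : JetBase | basePt T b ∈ V} :=
  hV.preimage (contDiff_basePt T).continuous

/-- The raw normal is smooth on the jet bases over `V` (index raising is smooth,
`MetricCoord.IsMetricOn.contDiffOn_sharpAt`). [folklore] -/
theorem contDiffOn_rawNormal (hG : MetricCoord.IsMetricOn G V) :
    ContDiffOn ℝ ∞ (rawNormal T G) {b : JetBase | basePt T b ∈ V} := by
  unfold rawNormal
  refine ContDiffOn.clm_apply ?_ ?_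
  · exact hG.contDiffOn_sharpAt.comp (contDiff_basePt T).contDiffOn fun b hb ↦ hb
  · exact ((contDiff_levelCovector T).comp contDiff_fst).contDiffOn

/-- The squared length of the raw normal is smooth on the jet bases over `V`. [folklore] -/
theorem contDiffOn_normSq (hG : MetricCoord.IsMetricOn G V) :
    ContDiffOn ℝ ∞ (normSq T G) {b : JetBase | basePt T b ∈ V} := by
  unfold normSq
  exact ((contDiff_levelCovector T).comp contDiff_fst).contDiffOn.clm_apply (contDiffOn_rawNormal hG)

/-- **The unit normal is smooth** on the jet bases over `V`, for `G` positive definite on `V`.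
[cite: FonteneleSilva2001, §3 (η depends smoothly on x, µ, µ_i)] -/
theorem contDiffOn_unitNormal (hG : MetricCoord.IsMetricOn G V)
    (hpos : ∀ y ∈ V, ∀ v : E3, v ≠ 0 → 0 < G y v v) :
    ContDiffOn ℝ ∞ (unitNormal T G) {b : JetBase | basePt T b ∈ V} := by
  have hW : ∀ b ∈ {b : JetBase | basePt T b ∈ V}, normSq T G b ≠ 0 := fun b hb ↦
    (normSq_pos (hG.isInvertible _ hb) (hpos _ hb)).ne'
  have hsqrt : ∀ b ∈ {b : JetBase | basePt T b ∈ V}, Real.sqrt (normSq T G b) ≠ 0 := fun b hb ↦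
    (Real.sqrt_pos.2 (normSq_pos (hG.isInvertible _ hb) (hpos _ hb))).ne'
  unfold unitNormal
  exact (((contDiffOn_normSq hG).sqrt hW).inv hsqrt).smul (contDiffOn_rawNormal hG)

/-- The derivative of the unit normal is smooth on the jet bases over `V`. [folklore] -/
theorem contDiffOn_fderiv_unitNormal (hG : MetricCoord.IsMetricOn G V)
    (hpos : ∀ y ∈ V, ∀ v : E3, v ≠ 0 → 0 < G y v v) :
    ContDiffOn ℝ ∞ (fderiv ℝ (unitNormal T G)) {b : JetBase | basePt T b ∈ V} :=
  (contDiffOn_unitNormal hG hpos).fderiv_of_isOpen (isOpen_basePt_preimage hG.isOpen)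
    (le_of_eq (rfl : ((∞ : ℕ∞ω) + 1) = ∞))

/-- The unit normal is differentiable at the jet bases over `V`. [folklore] -/
theorem differentiableAt_unitNormal (hG : MetricCoord.IsMetricOn G V)
    (hpos : ∀ y ∈ V, ∀ v : E3, v ≠ 0 → 0 < G y v v) {b : JetBase} (hb : basePt T b ∈ V) :
    DifferentiableAt ℝ (unitNormal T G) b :=
  ((contDiffOn_unitNormal hG hpos).contDiffAt
    ((isOpen_basePt_preimage hG.isOpen).mem_nhds hb)).differentiableAt (by simp)

/-- The unit normal as a function of the gradient slot alone has derivative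
`w ↦ DN(b)(w, 0, 0)` there. [folklore] -/
theorem hasFDerivAt_unitNormal_slot (hG : MetricCoord.IsMetricOn G V)
    (hpos : ∀ y ∈ V, ∀ v : E3, v ≠ 0 → 0 < G y v v) {b : JetBase} (hb : basePt T b ∈ V) :
    HasFDerivAt (fun q' : Fin 2 → ℝ ↦ unitNormal T G (q', b.2))
      ((fderiv ℝ (unitNormal T G) b).comp
        (ContinuousLinearMap.inl ℝ (Fin 2 → ℝ) (ℝ × EuclideanSpace ℝ (Fin 2)))) b.1 := by
  have hg : HasFDerivAt (unitNormal T G) (fderiv ℝ (unitNormal T G) b)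
      ((fun q' : Fin 2 → ℝ ↦ (q', b.2)) b.1) :=
    (differentiableAt_unitNormal hG hpos hb).hasFDerivAt
  have hf : HasFDerivAt (fun q' : Fin 2 → ℝ ↦ ((q', b.2) : JetBase))
      (ContinuousLinearMap.inl ℝ (Fin 2 → ℝ) (ℝ × EuclideanSpace ℝ (Fin 2))) b.1 :=
    hasFDerivAt_prodMk_left (𝕜 := ℝ) b.1 b.2
  exact hg.comp b.1 hf

/-- **The ellipticity identity for the full derivative of the unit normal**:
`G_y(DN(b)(w, 0, 0), A_q c) = −(Σ wᵢ cᵢ)/W` at every jet base over `V`.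
[cite: FonteneleSilva2001, Prop. 3.4 (r = 1)] -/
theorem apply_fderiv_unitNormal_inl_graphDiff (hG : MetricCoord.IsMetricOn G V)
    (hpos : ∀ y ∈ V, ∀ v : E3, v ≠ 0 → 0 < G y v v) {b : JetBase} (hb : basePt T b ∈ V)
    (w : Fin 2 → ℝ) (c : EuclideanSpace ℝ (Fin 2)) :
    G (basePt T b) (fderiv ℝ (unitNormal T G) b (w, 0, 0)) (graphDiff T b.1 c) =
      -((Real.sqrt (normSq T G b))⁻¹ * ∑ i, w i * c i) := by
  have h := apply_fderiv_unitNormal_graphDiff (hG.isInvertible _ hb)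
    (hasFDerivAt_unitNormal_slot hG hpos hb) w c
  rw [ContinuousLinearMap.comp_apply, ContinuousLinearMap.inl_apply] at h
  rw [show ((w, 0) : JetBase) = (w, 0, 0) from rfl] at h
  exact h

end Regularity

/-! ### The operator -/

section Operator

variable (T G)

/-- The standard basis vector `eᵢ` of `ℝ²`. [folklore] -/
def stdVec (i : Fin 2) : EuclideanSpace ℝ (Fin 2) :=
  EuclideanSpace.single i (1 : ℝ)

/-- Coordinates of the standard basis vectors. [folklore] -/
@[simp]
theorem stdVec_apply (i k : Fin 2) : stdVec i k = if k = i then 1 else 0 := by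
  simp [stdVec]

/-- **The jet prolongation direction.** For a `C²` function `u` with jet `(r, q, z, x)` at `x`
(`r = D²u`, `q = ∇u`, `z = u x`), the map `x ↦ (∇u(x), u(x), x)` into the jet bases has
derivative `a ↦ ((Σᵢ aᵢ rᵢⱼ)ⱼ, Σᵢ qᵢ aᵢ, a)` at `x`. [cite: FonteneleSilva2001, §2 (2.2)] -/
def jetDir (p : Jet 2) (a : EuclideanSpace ℝ (Fin 2)) : JetBase :=
  (fun j ↦ ∑ i, a i * p.1 i j, ∑ i, p.2.1 i * a i, a)

/-- The prolongation direction along `eᵢ` is `(rᵢ, qᵢ, eᵢ)`. [folklore] -/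
theorem jetDir_stdVec (p : Jet 2) (i : Fin 2) :
    jetDir p (stdVec i) = (p.1 i, p.2.1 i, stdVec i) := by
  refine Prod.ext ?_ (Prod.ext ?_ rfl)
  · funext j
    simp [jetDir, ite_mul, Finset.sum_ite_eq']
  · simp [jetDir, mul_ite, Finset.sum_ite_eq']

/-- The derivative of the unit normal of the graph along `a`: `DN(q, z, x)(jetDir p a)` (chain
rule for `x ↦ N(∇u x, u x, x)`). [cite: FonteneleSilva2001, §3 (3.3)] -/
def unitNormalDeriv (p : Jet 2) (a : EuclideanSpace ℝ (Fin 2)) : E3 :=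
  fderiv ℝ (unitNormal T G) p.2 (jetDir p a)

/-- **The symbol of the second fundamental form** of a graph with jet `p`:
`K̃_p(a, c) = G_y(DN(jetDir p a) + Γ_y(A_q a, N), A_q c)` — the coordinate formula
`K_ν(v, w) = g(Dν(v) + Γ(dF v, ν), dF w)` (O'Neill 1983, Ch. 4, Lemma 4.1) for the graph map
`F = Gr_u` and its unit normal `ν = N ∘ (∇u, u, id)`, written on the jet; `Γ_y = chrAt G y`.
[cite: FonteneleSilva2001, §3 (3.3)–(3.4)] -/
def sff (p : Jet 2) (a c : EuclideanSpace ℝ (Fin 2)) : ℝ :=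
  G (basePt T p.2)
    (unitNormalDeriv T G p a +
      MetricCoord.chrAt G (basePt T p.2) (graphDiff T p.2.1 a) (unitNormal T G p.2))
    (graphDiff T p.2.1 c)

/-- **The symbol of the first fundamental form** of a graph: `γ̃_b(a, c) = G_y(A_q a, A_q c)`
(the matrix `I(x)` of Fontenele–Silva 2001, Lemma 3.1, on the jet base).
[cite: FonteneleSilva2001, Lemma 3.1] -/
def firstFF (b : JetBase) (a c : EuclideanSpace ℝ (Fin 2)) : ℝ :=
  G (basePt T b) (graphDiff T b.1 a) (graphDiff T b.1 c)

/-- The Gram matrix `(γ̃_b(eᵢ, eⱼ))ᵢⱼ` of the first fundamental form. [cite: FonteneleSilva2001, Lemma 3.1] -/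
def gram (b : JetBase) : Matrix (Fin 2) (Fin 2) ℝ :=
  Matrix.of fun i j ↦ firstFF T G b (stdVec i) (stdVec j)

/-- **The minimal-graph operator of the chart** on second-order jets:
`Φ(p) = −Σᵢⱼ (γ̃⁻¹)ⱼᵢ K̃_p(eᵢ, eⱼ)`, i.e. minus the trace of the second fundamental form symbol
with respect to the first (the shape of `PseudoRiemannianMetric.trace_eq_sum_gram_inv`); up to the
sign and the positive factor this is `Φ₁ = (1/n) tr(I⁻¹ II)` of Fontenele–Silva 2001, Prop. 3.2
(`r = 1`), and `H = Σ aⁱʲ Dᵢⱼf + b` of Andersson–Galloway–Howard 1998, §3.1. The sign is chosen so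
that the symbol is positive (`isEllipticAt_operator`). [cite: FonteneleSilva2001, Prop. 3.2 (r = 1)] -/
def operator (p : Jet 2) : ℝ :=
  -∑ i, ∑ j, (gram T G p.2)⁻¹ j i * sff T G p (stdVec i) (stdVec j)

variable {T G} {V : Set E3}

/-- **The operator is affine in the Hessian slot, with explicit linear part.** At a jet over `V`,
`K̃_p(eᵢ, eⱼ) = −rᵢⱼ / W + K̃_{(0, q, z, x)}(eᵢ, eⱼ)` (linearity of `DN` and the ellipticity
identity `apply_fderiv_unitNormal_inl_graphDiff`). [cite: FonteneleSilva2001, §3 (3.4): r_kl enters linearly] -/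
theorem sff_stdVec_eq (hG : MetricCoord.IsMetricOn G V)
    (hpos : ∀ y ∈ V, ∀ v : E3, v ≠ 0 → 0 < G y v v) {p : Jet 2} (hp : basePt T p.2 ∈ V)
    (i j : Fin 2) :
    sff T G p (stdVec i) (stdVec j) =
      -((Real.sqrt (normSq T G p.2))⁻¹ * p.1 i j) + sff T G ((0, p.2) : Jet 2) (stdVec i) (stdVec j) := by
  have hsplit : ((p.1 i, p.2.1 i, stdVec i) : JetBase) =
      ((p.1 i, 0, 0) : JetBase) + (((0 : Fin 2 → Fin 2 → ℝ) i, p.2.1 i, stdVec i) : JetBase) := by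
    simp
  have hkey := apply_fderiv_unitNormal_inl_graphDiff hG hpos hp (p.1 i) (stdVec j)
  have hsum : ∑ k, p.1 i k * stdVec j k = p.1 i j := by
    simp [mul_ite, Finset.sum_ite_eq']
  rw [hsum] at hkey
  simp only [sff, unitNormalDeriv, jetDir_stdVec]
  rw [hsplit, map_add (fderiv ℝ (unitNormal T G) p.2), add_assoc, map_add (G (basePt T p.2)),
    add_apply, hkey]

/-- **The operator is affine in the Hessian slot**:
`Φ(r, q, z, x) = (Σᵢⱼ (γ̃⁻¹)ⱼᵢ rᵢⱼ) / W + Φ(0, q, z, x)` at every jet over `V`.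
[cite: AnderssonGallowayHoward1998, §3.1 (H = Σ aⁱʲ Dᵢⱼf + b)] -/
theorem operator_eq (hG : MetricCoord.IsMetricOn G V)
    (hpos : ∀ y ∈ V, ∀ v : E3, v ≠ 0 → 0 < G y v v) {p : Jet 2} (hp : basePt T p.2 ∈ V) :
    operator T G p =
      (Real.sqrt (normSq T G p.2))⁻¹ * (∑ i, ∑ j, (gram T G p.2)⁻¹ j i * p.1 i j) +
        operator T G ((0, p.2) : Jet 2) := by
  simp only [operator]
  have h : ∀ i j, (gram T G p.2)⁻¹ j i * sff T G p (stdVec i) (stdVec j) =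
      -((Real.sqrt (normSq T G p.2))⁻¹ * ((gram T G p.2)⁻¹ j i * p.1 i j)) +
        (gram T G p.2)⁻¹ j i * sff T G ((0, p.2) : Jet 2) (stdVec i) (stdVec j) := by
    intro i j
    rw [sff_stdVec_eq hG hpos hp]
    ring
  simp_rw [h, Finset.sum_add_distrib, Finset.sum_neg_distrib, ← Finset.mul_sum]
  ring

end Operator

/-! ### Positivity of the first fundamental form; regularity of the operator -/

section GramRegularity

variable {V : Set E3}

/-- Bilinearity: `Σᵢⱼ xᵢ γ̃(eᵢ, eⱼ) xⱼ = γ̃(Σ xᵢ eᵢ, Σ xⱼ eⱼ)`. [folklore] -/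
theorem sum_sum_mul_firstFF (b : JetBase) (x : Fin 2 → ℝ) :
    ∑ i, ∑ j, x i * (firstFF T G b (stdVec i) (stdVec j) * x j) =
      G (basePt T b) (graphDiff T b.1 (∑ i, x i • stdVec i))
        (graphDiff T b.1 (∑ j, x j • stdVec j)) := by
  simp only [firstFF, map_sum, map_smul, sum_apply, smul_apply, smul_eq_mul]
  rw [Finset.sum_comm]
  refine Finset.sum_congr rfl fun i _ ↦ ?_
  rw [Finset.mul_sum]
  refine Finset.sum_congr rfl fun j _ ↦ ?_
  ring

/-- The vector with coordinates `x` vanishes only if `x = 0`. [folklore] -/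
theorem sum_smul_stdVec_ne_zero {x : Fin 2 → ℝ} (hx : x ≠ 0) : (∑ i, x i • stdVec i) ≠ 0 := by
  intro h
  apply hx
  funext k
  have hk := congrArg (fun v : EuclideanSpace ℝ (Fin 2) ↦ v k) h
  fin_cases k <;> simpa [Fin.sum_univ_two] using hk

/-- **The Gram matrix of the first fundamental form is positive definite** (the graph
differential is injective and `G_y` is positive definite) — Fontenele–Silva 2001, after (3.5):
"F(rᵢ, z, yᵢ) is a definite positive symmetric matrix". [cite: FonteneleSilva2001, Lemma 3.1] -/
theorem gram_posDef {b : JetBase} (hsym : ∀ v w : E3, G (basePt T b) v w = G (basePt T b) w v)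
    (hpos : ∀ v : E3, v ≠ 0 → 0 < G (basePt T b) v v) : (gram T G b).PosDef := by
  refine Matrix.PosDef.of_dotProduct_mulVec_pos ?_ ?_
  · refine Matrix.IsHermitian.ext fun i j ↦ ?_
    simp only [star_trivial, gram, Matrix.of_apply, firstFF]
    exact hsym _ _
  · intro x hx
    have h : star x ⬝ᵥ (gram T G b *ᵥ x) =
        ∑ i, ∑ j, x i * (firstFF T G b (stdVec i) (stdVec j) * x j) := by
      simp only [star_trivial, dotProduct, Matrix.mulVec, gram, Matrix.of_apply, Finset.mul_sum]
    rw [h, sum_sum_mul_firstFF]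
    exact hpos _ fun h0 ↦ sum_smul_stdVec_ne_zero hx
      (graphDiff_injective T b.1 (h0.trans (map_zero _).symm))

/-- The Gram matrix is invertible: its determinant does not vanish. [folklore] -/
theorem det_gram_ne_zero {b : JetBase} (hsym : ∀ v w : E3, G (basePt T b) v w = G (basePt T b) w v)
    (hpos : ∀ v : E3, v ≠ 0 → 0 < G (basePt T b) v v) : (gram T G b).det ≠ 0 :=
  ((Matrix.isUnit_iff_isUnit_det _).mp (gram_posDef hsym hpos).isUnit).ne_zero

/-- Entries of the inverse Gram matrix: `(γ̃⁻¹)ᵢⱼ = adj(γ̃)ᵢⱼ / det γ̃`. [folklore] -/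
theorem gram_inv_apply (b : JetBase) (i j : Fin 2) :
    (gram T G b)⁻¹ i j = ((gram T G b).det)⁻¹ * (gram T G b).adjugate i j := by
  rw [Matrix.inv_def, Matrix.smul_apply, Ring.inverse_eq_inv, smul_eq_mul]

/-- The entries of the Gram matrix are smooth on the jet bases over `V`. [folklore] -/
theorem contDiffOn_gram_apply (hG : MetricCoord.IsMetricOn G V) (k l : Fin 2) :
    ContDiffOn ℝ ∞ (fun b : JetBase ↦ gram T G b k l) {b : JetBase | basePt T b ∈ V} := by
  simp only [gram, Matrix.of_apply, firstFF]
  exact ((hG.contDiffOn.comp (contDiff_basePt T).contDiffOn fun b hb ↦ hb).clm_apply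
    ((contDiff_graphDiff_apply T _).comp contDiff_fst).contDiffOn).clm_apply
    ((contDiff_graphDiff_apply T _).comp contDiff_fst).contDiffOn

/-- The determinant of the Gram matrix is smooth on the jet bases over `V`. [folklore] -/
theorem contDiffOn_det_gram (hG : MetricCoord.IsMetricOn G V) :
    ContDiffOn ℝ ∞ (fun b : JetBase ↦ (gram T G b).det) {b : JetBase | basePt T b ∈ V} := by
  simp only [Matrix.det_fin_two]
  exact ((contDiffOn_gram_apply hG 0 0).mul (contDiffOn_gram_apply hG 1 1)).sub
    ((contDiffOn_gram_apply hG 0 1).mul (contDiffOn_gram_apply hG 1 0))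

/-- The adjugate of the Gram matrix is smooth on the jet bases over `V`. [folklore] -/
theorem contDiffOn_adjugate_gram (hG : MetricCoord.IsMetricOn G V) (i j : Fin 2) :
    ContDiffOn ℝ ∞ (fun b : JetBase ↦ (gram T G b).adjugate i j) {b : JetBase | basePt T b ∈ V} := by
  simp only [Matrix.adjugate_fin_two]
  fin_cases i <;> fin_cases j
  · simpa using contDiffOn_gram_apply hG 1 1
  · simpa using (contDiffOn_gram_apply hG 0 1).neg
  · simpa using (contDiffOn_gram_apply hG 1 0).neg
  · simpa using contDiffOn_gram_apply hG 0 0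

/-- **The inverse Gram matrix is smooth** on the jet bases over `V`, for `G` positive definite on
`V`. [cite: FonteneleSilva2001, Lemma 3.1 (F⁻¹ smooth on ℝⁿ × 𝒩)] -/
theorem contDiffOn_gram_inv_apply (hG : MetricCoord.IsMetricOn G V)
    (hpos : ∀ y ∈ V, ∀ v : E3, v ≠ 0 → 0 < G y v v) (i j : Fin 2) :
    ContDiffOn ℝ ∞ (fun b : JetBase ↦ (gram T G b)⁻¹ i j) {b : JetBase | basePt T b ∈ V} := by
  have h : (fun b : JetBase ↦ (gram T G b)⁻¹ i j) =
      fun b ↦ ((gram T G b).det)⁻¹ * (gram T G b).adjugate i j :=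
    funext fun b ↦ gram_inv_apply b i j
  rw [h]
  refine ((contDiffOn_det_gram hG).inv fun b hb ↦ ?_).mul (contDiffOn_adjugate_gram hG i j)
  exact det_gram_ne_zero (hG.symm _ hb) (hpos _ hb)

/-- The jet prolongation direction is a smooth (polynomial) function of the jet. [folklore] -/
theorem contDiff_jetDir (a : EuclideanSpace ℝ (Fin 2)) : ContDiff ℝ ∞ (fun p : Jet 2 ↦ jetDir p a) := by
  unfold jetDir
  refine (contDiff_pi.2 fun j ↦ ?_).prodMk ((ContDiff.sum fun i _ ↦ ?_).prodMk contDiff_const)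
  · exact ContDiff.sum fun i _ ↦
      contDiff_const.mul ((contDiff_apply_apply ℝ ℝ i j).comp contDiff_fst)
  · exact ((contDiff_apply ℝ ℝ i).comp (contDiff_fst.comp contDiff_snd)).mul contDiff_const

/-- **The second fundamental form symbol is smooth** on the jets over `V`.
[cite: FonteneleSilva2001, Lemma 3.1 (G smooth on ℝ^{n(n+1)/2+n} × 𝒩)] -/
theorem contDiffOn_sff (hG : MetricCoord.IsMetricOn G V)
    (hpos : ∀ y ∈ V, ∀ v : E3, v ≠ 0 → 0 < G y v v) (a c : EuclideanSpace ℝ (Fin 2)) :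
    ContDiffOn ℝ ∞ (fun p : Jet 2 ↦ sff T G p a c) {p : Jet 2 | basePt T p.2 ∈ V} := by
  have hS : ∀ p ∈ {p : Jet 2 | basePt T p.2 ∈ V}, p.2 ∈ {b : JetBase | basePt T b ∈ V} :=
    fun p hp ↦ hp
  have hGb : ContDiffOn ℝ ∞ (fun p : Jet 2 ↦ G (basePt T p.2)) {p : Jet 2 | basePt T p.2 ∈ V} :=
    hG.contDiffOn.comp ((contDiff_basePt T).comp contDiff_snd).contDiffOn fun p hp ↦ hp
  have hN : ContDiffOn ℝ ∞ (fun p : Jet 2 ↦ unitNormal T G p.2) {p : Jet 2 | basePt T p.2 ∈ V} :=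
    (contDiffOn_unitNormal hG hpos).comp contDiff_snd.contDiffOn hS
  have hDN : ContDiffOn ℝ ∞ (fun p : Jet 2 ↦ fderiv ℝ (unitNormal T G) p.2)
      {p : Jet 2 | basePt T p.2 ∈ V} :=
    (contDiffOn_fderiv_unitNormal hG hpos).comp contDiff_snd.contDiffOn hS
  have hA : ∀ c : EuclideanSpace ℝ (Fin 2), ContDiff ℝ ∞ (fun p : Jet 2 ↦ graphDiff T p.2.1 c) :=
    fun c ↦ (contDiff_graphDiff_apply T c).comp (contDiff_fst.comp contDiff_snd)
  have hchr : ContDiffOn ℝ ∞ (fun p : Jet 2 ↦ MetricCoord.chrAt G (basePt T p.2))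
      {p : Jet 2 | basePt T p.2 ∈ V} :=
    hG.contDiffOn_chrAt.comp ((contDiff_basePt T).comp contDiff_snd).contDiffOn fun p hp ↦ hp
  unfold sff unitNormalDeriv
  exact (hGb.clm_apply ((hDN.clm_apply (contDiff_jetDir a).contDiffOn).add
    ((hchr.clm_apply (hA a).contDiffOn).clm_apply hN))).clm_apply (hA c).contDiffOn

/-- **The minimal-graph operator is smooth** on the jets based in `V` (in particular `C¹`, as
required by `MinimalGraphOperator.contDiffOn`). [cite: FonteneleSilva2001, Prop. 3.2 (Φ_r differentiable)] -/
theorem contDiffOn_operator (hG : MetricCoord.IsMetricOn G V)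
    (hpos : ∀ y ∈ V, ∀ v : E3, v ≠ 0 → 0 < G y v v) :
    ContDiffOn ℝ ∞ (operator T G) {p : Jet 2 | basePt T p.2 ∈ V} := by
  unfold operator
  refine ContDiffOn.neg (ContDiffOn.sum fun i _ ↦ ContDiffOn.sum fun j _ ↦ ?_)
  exact ((contDiffOn_gram_inv_apply hG hpos j i).comp contDiff_snd.contDiffOn fun p hp ↦ hp).mul
    (contDiffOn_sff hG hpos _ _)

end GramRegularity

/-! ### Ellipticity -/

section Ellipticity

variable (T G)

/-- The linear part of the operator in the Hessian slot, `ρ ↦ Σᵢⱼ (γ̃⁻¹)ⱼᵢ ρᵢⱼ`, as a continuous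
linear functional. [folklore] -/
def hessianPart (b : JetBase) : (Fin 2 → Fin 2 → ℝ) →L[ℝ] ℝ :=
  ∑ i, ∑ j, (gram T G b)⁻¹ j i •
    ((ContinuousLinearMap.proj j : (Fin 2 → ℝ) →L[ℝ] ℝ).comp
      (ContinuousLinearMap.proj i : (Fin 2 → Fin 2 → ℝ) →L[ℝ] (Fin 2 → ℝ)))

/-- `hessianPart b ρ = Σᵢⱼ (γ̃⁻¹)ⱼᵢ ρᵢⱼ`. [folklore] -/
theorem hessianPart_apply (b : JetBase) (r : Fin 2 → Fin 2 → ℝ) :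
    hessianPart T G b r = ∑ i, ∑ j, (gram T G b)⁻¹ j i * r i j := by
  simp [hessianPart]

variable {T G} {V : Set E3}

/-- The derivative of the operator restricted to the Hessian slot: `ρ ↦ hessianPart(ρ) / W`
(`operator_eq`). [folklore] -/
theorem hasFDerivAt_operator_slot (hG : MetricCoord.IsMetricOn G V)
    (hpos : ∀ y ∈ V, ∀ v : E3, v ≠ 0 → 0 < G y v v) {p : Jet 2} (hp : basePt T p.2 ∈ V) :
    HasFDerivAt (fun r : Fin 2 → Fin 2 → ℝ ↦ operator T G ((r, p.2) : Jet 2))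
      ((Real.sqrt (normSq T G p.2))⁻¹ • hessianPart T G p.2) p.1 := by
  have h : (fun r : Fin 2 → Fin 2 → ℝ ↦ operator T G ((r, p.2) : Jet 2)) = fun r ↦
      (Real.sqrt (normSq T G p.2))⁻¹ * hessianPart T G p.2 r + operator T G ((0, p.2) : Jet 2) := by
    funext r
    rw [operator_eq hG hpos (p := ((r, p.2) : Jet 2)) hp, hessianPart_apply]
  rw [h]
  exact (((hessianPart T G p.2).hasFDerivAt).const_mul _).add_const _

/-- **Ellipticity of the minimal-graph operator** (Fontenele–Silva 2001, Prop. 3.4 for `r = 1`: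
"Σ ∂Φ₁/∂r_kl ξ_k ξ_l = (ω/n) ξᵀ F ξ > 0"): at every jet based in `V`,
`∂Φ/∂r (ξξᵀ) = (ξᵀ γ̃⁻¹ ξ) / W > 0` for `ξ ≠ 0`, the inverse Gram matrix of the first fundamental
form being positive definite. [cite: FonteneleSilva2001, Prop. 3.4 (r = 1)] -/
theorem isEllipticAt_operator (hG : MetricCoord.IsMetricOn G V)
    (hpos : ∀ y ∈ V, ∀ v : E3, v ≠ 0 → 0 < G y v v) {p : Jet 2} (hp : basePt T p.2 ∈ V) :
    IsEllipticAt (operator T G) p := by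
  intro ξ hξ
  have hopen : IsOpen {p : Jet 2 | basePt T p.2 ∈ V} :=
    hG.isOpen.preimage ((contDiff_basePt T).continuous.comp continuous_snd)
  have hd : DifferentiableAt ℝ (operator T G) p :=
    ((contDiffOn_operator hG hpos).contDiffAt (hopen.mem_nhds hp)).differentiableAt (by simp)
  -- the derivative of the restriction to the Hessian slot, in two ways
  have h1 : HasFDerivAt (fun r : Fin 2 → Fin 2 → ℝ ↦ operator T G ((r, p.2) : Jet 2))
      ((fderiv ℝ (operator T G) p).comp
        (ContinuousLinearMap.inl ℝ (Fin 2 → Fin 2 → ℝ) JetBase)) p.1 := by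
    have hg : HasFDerivAt (operator T G) (fderiv ℝ (operator T G) p)
        ((fun r : Fin 2 → Fin 2 → ℝ ↦ ((r, p.2) : Jet 2)) p.1) := hd.hasFDerivAt
    have hf : HasFDerivAt (fun r : Fin 2 → Fin 2 → ℝ ↦ ((r, p.2) : Jet 2))
        (ContinuousLinearMap.inl ℝ (Fin 2 → Fin 2 → ℝ) JetBase) p.1 :=
      hasFDerivAt_prodMk_left (𝕜 := ℝ) p.1 p.2
    exact hg.comp p.1 hf
  have heq := h1.unique (hasFDerivAt_operator_slot hG hpos hp)
  have hval : fderiv ℝ (operator T G) p (fun i j ↦ ξ i * ξ j, 0, 0, 0) =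
      (Real.sqrt (normSq T G p.2))⁻¹ * ∑ i, ∑ j, (gram T G p.2)⁻¹ j i * (ξ i * ξ j) := by
    have h := DFunLike.congr_fun heq (fun i j ↦ ξ i * ξ j)
    rw [ContinuousLinearMap.comp_apply, ContinuousLinearMap.inl_apply] at h
    rw [show (((fun i j ↦ ξ i * ξ j), 0) : Jet 2) = (fun i j ↦ ξ i * ξ j, 0, 0, 0) from rfl] at h
    rw [h, smul_apply, hessianPart_apply, smul_eq_mul]
  rw [hval]
  refine mul_pos (inv_pos.2 (Real.sqrt_pos.2 (normSq_pos (hG.isInvertible _ hp) (hpos _ hp)))) ?_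
  -- positivity of the quadratic form of the inverse Gram matrix
  have hPD := (gram_posDef (T := T) (G := G) (b := p.2) (hG.symm _ hp) (hpos _ hp)).inv
  have hq := hPD.dotProduct_mulVec_pos hξ
  have hsum : star ξ ⬝ᵥ ((gram T G p.2)⁻¹ *ᵥ ξ) =
      ∑ i, ∑ j, (gram T G p.2)⁻¹ j i * (ξ i * ξ j) := by
    simp only [star_trivial, dotProduct, Matrix.mulVec, Finset.mul_sum]
    rw [Finset.sum_comm]
    refine Finset.sum_congr rfl fun i _ ↦ Finset.sum_congr rfl fun j _ ↦ ?_
    ring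
  rwa [hsum] at hq

end Ellipticity

end MinimalGraph

end Literature.Geometry.Lorentzian

end
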